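import Mathlib
import HarnessLib
import Summits.ValiantsHypothesis.ValiantsHypothesis.Theorems.MonotoneRestorationOrbitRestorationLinearVolumeQPSimplePatternVH
import Literature.Computability.AlgebraicComplexity.DawarWilsenach2025Thm71

/-!
# Sub-exponential ORBITS already decide: symmetric circuits of orbit size `2^{o(n)}` for the `VP` hom families of
# single simple patterns with `≤ n` rows, columns and edges ⇒ VP ≠ VNP

Route MonotoneRestoration, aside R1 = `OrbitRestorationLinearVolumeQP` (stmt-ValiantsHypothesis-18294).  The separating
pattern family behind `valiantsHypothesis_of_orbitRestorationLinearVolumeQP` separates `≡^{C^k}`-equivalent graphs at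
LINEAR `k ≥ ε m` (Dawar–Wilsenach Thm 7.2: `m ≤ c k + c`), not merely polylogarithmic.  So the quasi-polynomial orbit
bound in the deciders of `…AdmissiblePatternVH.lean` / `…SimplePatternVH.lean` can be relaxed to SUB-EXPONENTIAL:

* `not_subexpOrbitSymmetric_of_linearSeparating` — orbit-form engine at linear counting width (the Dawar–Wilsenach
  deduction of Thm 7.1, p. 19, for an arbitrary family: Thm 5.1 `DawarWilsenach2025_thm51_family`, Thm 6.4
  `DawarWilsenach2025_orbitSize_countingWidth_holds`): a family whose values separate, beyond every order, two
  `≡^{C^k}`-equivalent graphs with `k ≥ ε n` has NO square-symmetric circuits of orbit size `2^{o(n)}`;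
* `exists_linearlySeparating_simple_vnp_family` — unconditionally, single SIMPLE bipartite patterns with `≤ n` rows,
  columns, edges whose hom polynomials are `VNP` and LINEARLY separating;
* `valiantsHypothesis_of_subexpOrbitSimplePatternRestoration` — **if every `VP` family `(hom_{F_n,n})_n` of single
  simple bipartite patterns with `≤ n` rows, columns and edges has square-symmetric circuits of orbit size `2^{o(n)}`
  (for every `δ > 0` eventually `≤ 2^{δ n}`), then `VP ≠ VNP` over `ℂ`** — the weakest decider of this file family;
* `not_subexpOrbitSimplePatternRestoration_vnp` — its `VNP` version is false.

Honest framing: implications/tightness; nothing is proved about VP ≠ VNP.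
-/

noncomputable section

-- `Summit.ValiantsHypothesis.ValiantsHypothesis.…` is the tree's single-conjunct layout (Sub = Summit).
set_option linter.dupNamespace false

open scoped Classical

namespace Summit.ValiantsHypothesis.ValiantsHypothesis.Theorems

namespace OrbitRestorationLinearVolumeQPVHStrength

open MvPolynomial Filter
open Summit.ValiantsHypothesis.ValiantsHypothesis.Theses.MonotoneRestoration
open Literature.Computability.AlgebraicComplexity
open Literature.ModelTheory.FiniteModelTheory
open Literature.Computability.Complexity (Circuit tcBasis)

/-- **Orbit-form engine at linear counting width.**  If the values of `f n` at `0/1` adjacency matrices separate,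
beyond every order `N`, two `≡^{C^k}`-equivalent graphs on `Fin n` (`n ≥ N`) with `k ≥ ε n` for one fixed `ε > 0`, then
`f` has no square-symmetric circuits of orbit size `2^{o(n)}`.  (Dawar–Wilsenach's deduction of Thm 7.1 with the
permanent replaced by `f`: Thm 5.1 gives symmetric threshold circuits of orbit size `2^{o(n)}` deciding the class
"same value as the reference graph of this order", Thm 6.4 makes that class eventually `≡^{C^{εn}}`-invariant.)
[cite: DawarWilsenach2025, Thm 5.1, Thm 6.4, §7.1 (proof of Thm 7.1, p. 19)] -/
theorem not_subexpOrbitSymmetric_of_linearSeparating (f : (n : ℕ) → MvPolynomial (Fin n × Fin n) ℂ)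
    (hsep : ∃ ε : ℝ, 0 < ε ∧ ∀ N : ℕ, ∃ n : ℕ, N ≤ n ∧ ∃ k : ℕ, ε * (n : ℝ) ≤ (k : ℝ) ∧
      ∃ X Y : SimpleGraph (Fin n), CkEquiv k X Y ∧
        eval (Set.indicator {ij : Fin n × Fin n | X.Adj ij.1 ij.2} 1) (f n) ≠
          eval (Set.indicator {ij : Fin n × Fin n | Y.Adj ij.1 ij.2} 1) (f n)) :
    ¬ ∃ (G : ℕ → Type) (_ : ∀ n, Fintype (G n)) (D : ∀ n, LabelledArithCircuit ℂ (Fin n × Fin n) Unit (G n)),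
      (∀ n, (D n).IsSymmetric (Equiv.Perm (Fin n))) ∧ (∀ n, (D n).eval ((D n).output ()) = f n) ∧
        ∀ δ : ℝ, 0 < δ → ∀ᶠ n : ℕ in atTop,
          ((D n).orbitSize (Equiv.Perm (Fin n)) : ℝ) ≤ (2 : ℝ) ^ (δ * (n : ℝ)) := by
  -- adapted from the tree's `DawarWilsenach2025_thm71_of_thm51_thm64_thm72` (DawarWilsenach2025Proofs.lean)
  rintro ⟨G, inst, D, hsym, hev, horb⟩
  obtain ⟨ε, hε, hN⟩ := hsep
  choose nn hnn kk hkk X Y hXY hne using hN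
  -- Boolean adjacency matrices and values at them
  let adjB : ∀ n, SimpleGraph (Fin n) → Fin n × Fin n → Bool := fun n Γ ij => decide (Γ.Adj ij.1 ij.2)
  let val : ∀ n, (Fin n × Fin n → Bool) → ℂ := fun n A =>
    eval (fun ij => if A ij = true then (1 : ℂ) else 0) (f n)
  have hval : ∀ (n : ℕ) (Γ : SimpleGraph (Fin n)), val n (adjB n Γ) =
      eval (Set.indicator {ij : Fin n × Fin n | Γ.Adj ij.1 ij.2} 1) (f n) := by
    intro n Γ
    have hfun : (fun ij : Fin n × Fin n => if decide (Γ.Adj ij.1 ij.2) = true then (1 : ℂ) else 0) =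
        Set.indicator {ij : Fin n × Fin n | Γ.Adj ij.1 ij.2} 1 := by
      funext ij
      by_cases h : Γ.Adj ij.1 ij.2 <;> simp [h]
    simp only [val, adjB]
    rw [hfun]
  -- one index `N(n)` with `nn (N(n)) = n` whenever there is one; reference values; the class
  let Nsel : ℕ → ℕ := fun n => if h : ∃ N, nn N = n then h.choose else 0
  have hNsel : ∀ N, nn (Nsel (nn N)) = nn N := by
    intro N
    have h : ∃ N', nn N' = nn N := ⟨N, rfl⟩
    simp only [Nsel, dif_pos h]
    exact h.choose_spec
  let S : ℕ → Set ℂ := fun n => {val (nn (Nsel n)) (adjB (nn (Nsel n)) (X (Nsel n)))}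
  have hSfin : ∀ n, (S n).Finite := fun n => Set.finite_singleton _
  let 𝒞 : Set FinGraph := {Γ | val Γ.1 (adjB Γ.1 Γ.2) ∈ S Γ.1}
  -- Theorem 5.1: symmetric threshold circuits of orbit size `2^{o(n)}` deciding `𝒞`
  obtain ⟨Ψ, hΨ, hΨorb, hΨeval⟩ := DawarWilsenach2025_thm51_family ℂ G D S hsym hSfin horb
  have hdec : DecidesGraphClass 𝒞 Ψ := by
    intro n Γ _
    rw [hΨeval n (adjInput Γ), hev n]
    have hA : adjInput Γ = adjB n Γ := by
      funext ij
      simp [adjInput_apply, adjB]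
    rw [hA]
    exact Iff.rfl
  -- Theorem 6.4 at `ε`
  have hinv := DawarWilsenach2025_orbitSize_countingWidth_holds 𝒞 Ψ hΨ hdec hΨorb ε hε
  rw [Filter.eventually_atTop] at hinv
  obtain ⟨N₀, hN₀⟩ := hinv
  -- the separating pair beyond order `N₀`, re-selected
  set N' : ℕ := Nsel (nn N₀) with hN'_def
  have hnN' : nn N' = nn N₀ := hNsel N₀
  have hsel : Nsel (nn N') = N' := by rw [hnN']
  have hge : N₀ ≤ nn N' := by rw [hnN']; exact hnn N₀
  have hI : IsCkInvariantAt 𝒞 (nn N') (kk N') := hN₀ (nn N') hge (kk N') (hkk N')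
  have hXmem : (⟨nn N', X N'⟩ : FinGraph) ∈ 𝒞 := by
    show val (nn N') (adjB (nn N') (X N')) ∈ S (nn N')
    simp only [S, Set.mem_singleton_iff]
    rw [hsel]
  have hYmem : (⟨nn N', Y N'⟩ : FinGraph) ∉ 𝒞 := by
    show val (nn N') (adjB (nn N') (Y N')) ∉ S (nn N')
    simp only [S, Set.mem_singleton_iff]
    rw [hsel, hval, hval]
    exact (hne N').symm
  exact hYmem ((hI (X N') (Y N') (hXY N')).mp hXmem)

/-- **An unconditional LINEARLY separating `VNP` family of single simple patterns of admissible size**: simple bipartite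
patterns with `≤ n` rows, columns and edges whose hom polynomials are a `VNP` family and separate, beyond every order, two
`≡^{C^k}`-equivalent graphs with `k ≥ ε n` (Dawar–Wilsenach Thm 7.2 orders `m ≤ c k + c`; a separating generator of
the permanent's hom expansion, deduplicated; the empty pattern elsewhere). [cite: DawarWilsenach2025, Thm 7.2; DwivediPagoSeppelt2026, §4] -/
theorem exists_linearlySeparating_simple_vnp_family :
    ∃ (a b : ℕ → ℕ) (E : (n : ℕ) → Multiset (Fin (a n) × Fin (b n))),
      (∀ n, a n ≤ n) ∧ (∀ n, b n ≤ n) ∧ (∀ n, Multiset.card (E n) ≤ n) ∧ (∀ n, (E n).Nodup) ∧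
      IsVNPFamily (fun n => homPoly (E n) n ℂ) ∧
      ∃ ε : ℝ, 0 < ε ∧ ∀ N : ℕ, ∃ n : ℕ, N ≤ n ∧ ∃ k : ℕ, ε * (n : ℝ) ≤ (k : ℝ) ∧
        ∃ X' Y' : SimpleGraph (Fin n), CkEquiv k X' Y' ∧
          eval (Set.indicator {ij : Fin n × Fin n | X'.Adj ij.1 ij.2} 1) (homPoly (E n) n ℂ) ≠
            eval (Set.indicator {ij : Fin n × Fin n | Y'.Adj ij.1 ij.2} 1) (homPoly (E n) n ℂ) := by
  -- adapted from `exists_separating_admissible_vnp_family` / `exists_separating_simple_vnp_family`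
  obtain ⟨c, hc⟩ := CFIMatching.DawarWilsenach2025_thm72_family
  choose m hm X Y hXb hYb hXY hpm using hc
  have hne : ∀ k, eval (Set.indicator {ij : Fin (m k) × Fin (m k) | (X k).Adj ij.1 ij.2} 1)
      (perPoly (Fin (m k)) ℂ) ≠
      eval (Set.indicator {ij : Fin (m k) × Fin (m k) | (Y k).Adj ij.1 ij.2} 1) (perPoly (Fin (m k)) ℂ) := by
    intro k
    obtain ⟨s, t, hs, hst⟩ := hXb k
    obtain ⟨s', t', hs', hst'⟩ := hYb k
    rw [indicator_adj_eq, indicator_adj_eq]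
    exact eval_perPoly_adj_ne_of_card_perfectMatchings_ne hs hst hs' hst' ℂ (hpm k)
  have hkm : ∀ k, k < m k := by
    intro k
    by_contra hk
    have hk' : m k ≤ k := not_lt.mp hk
    apply hpm k
    rcases Nat.eq_zero_or_pos (m k) with h0 | hpos
    · have hXYeq : X k = Y k := by
        ext u v
        exact absurd u.isLt (by omega)
      rw [hXYeq]
    · rcases Nat.eq_zero_or_pos k with hk0 | hkpos
      · omega
      · obtain ⟨e⟩ := (hXY k).nonempty_iso hkpos (by simpa using hk')
        exact Literature.Probability.LatticeModels.card_perfectMatchings_eq_of_iso e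
  choose a b E ha hb hE hsepk using fun k => exists_pattern_separating (m k) (X k) (Y k) (hne k)
  let ksel : ℕ → ℕ := fun n => if h : ∃ k, m k = n then h.choose else 0
  have hksel : ∀ k, m (ksel (m k)) = m k := by
    intro k
    have h : ∃ k', m k' = m k := ⟨k, rfl⟩
    simp only [ksel, dif_pos h]
    exact h.choose_spec
  have hm0 : m 0 ≤ c := by simpa using hm 0
  let T : ℕ → (Σ ab : ℕ × ℕ, Multiset (Fin ab.1 × Fin ab.2)) := fun n =>
    if ∃ k, m k = n then ⟨(a (ksel n), b (ksel n)), (E (ksel n)).dedup⟩ else ⟨(0, 0), 0⟩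
  have hTgood : ∀ n, (∃ k, m k = n) → T n = ⟨(a (ksel n), b (ksel n)), (E (ksel n)).dedup⟩ :=
    fun n h => if_pos h
  have hTbad : ∀ n, (¬ ∃ k, m k = n) → T n = ⟨(0, 0), 0⟩ := fun n h => if_neg h
  have hsize : ∀ n, (T n).1.1 ≤ n ∧ (T n).1.2 ≤ n ∧ Multiset.card (T n).2 ≤ n ∧ (T n).2.Nodup := by
    intro n
    by_cases h : ∃ k, m k = n
    · have hk : m (ksel n) = n := by
        simp only [ksel, dif_pos h]
        exact h.choose_spec
      have h1 := ha (ksel n); have h2 := hb (ksel n); have h3 := hE (ksel n)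
      rw [hk] at h1 h2 h3
      rw [hTgood n h]
      exact ⟨h1, h2, (Multiset.card_le_card (Multiset.dedup_le _)).trans h3, Multiset.nodup_dedup _⟩
    · rw [hTbad n h]
      simp
  refine ⟨fun n => (T n).1.1, fun n => (T n).1.2, fun n => (T n).2, fun n => (hsize n).1, fun n => (hsize n).2.1,
    fun n => (hsize n).2.2.1, fun n => (hsize n).2.2.2, ?_, 1 / (2 * (c : ℝ) + 2), by positivity, fun N => ?_⟩
  · refine HomPolyVNP.isVNPFamily_homPoly ℂ (fun n => (T n).1.1) (fun n => (T n).1.2) (fun n => (T n).2) 1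
      (fun n => ?_) (fun n => ?_) (fun n => ?_)
    · exact (hsize n).1.trans (by rw [pow_one]; omega)
    · exact (hsize n).2.1.trans (by rw [pow_one]; omega)
    · exact (hsize n).2.2.1.trans (by rw [pow_one]; omega)
  · obtain ⟨k₀, hk₀_def⟩ : ∃ k₀ : ℕ, k₀ = N + c + 1 := ⟨_, rfl⟩
    obtain ⟨k', hk'_def⟩ : ∃ k' : ℕ, k' = ksel (m k₀) := ⟨_, rfl⟩
    have hmk' : m k' = m k₀ := by rw [hk'_def]; exact hksel k₀
    have hk₀m : k₀ < m k₀ := hkm k₀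
    have hsel : ksel (m k') = k' := by rw [hmk', hk'_def]
    have hk'1 : 1 ≤ k' := by
      by_contra h0
      have hz : k' = 0 := by omega
      have : m k' ≤ c := by rw [hz]; exact hm0
      omega
    refine ⟨m k', by omega, k', ?_, X k', Y k', hXY k', ?_⟩
    · have hmle : ((m k' : ℕ) : ℝ) ≤ (c : ℝ) * (k' : ℝ) + (c : ℝ) := by exact_mod_cast hm k'
      have hk1r : (1 : ℝ) ≤ (k' : ℝ) := by exact_mod_cast hk'1
      have hc0 : (0 : ℝ) ≤ (c : ℝ) := Nat.cast_nonneg c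
      rw [one_div, inv_mul_le_iff₀ (by positivity)]
      nlinarith [mul_nonneg hc0 (sub_nonneg.mpr hk1r)]
    · have hgood : ∃ k, m k = m k' := ⟨k', rfl⟩
      show eval _ (homPoly (T (m k')).2 (m k') ℂ) ≠ eval _ (homPoly (T (m k')).2 (m k') ℂ)
      rw [hTgood (m k') hgood]
      show eval _ (homPoly (E (ksel (m k'))).dedup (m k') ℂ) ≠ eval _ (homPoly (E (ksel (m k'))).dedup (m k') ℂ)
      rw [hsel, eval_indicator_homPoly_dedup, eval_indicator_homPoly_dedup]
      exact hsepk k'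

/-- **The weakest decider here: SUB-EXPONENTIAL orbits for single simple sparse patterns ⇒ VP ≠ VNP.**  If every `VP`
family of homomorphism polynomials of single SIMPLE bipartite patterns with at most `n` rows, `n` columns and `n` edges
has square-symmetric circuits of orbit size `2^{o(n)}` (for every `δ > 0`, eventually `≤ 2^{δ n}`), then Valiant's
hypothesis holds over `ℂ`. [cite: DawarWilsenach2025, Thm 5.1, Thm 6.4, Thm 7.2, §7.1] -/
theorem valiantsHypothesis_of_subexpOrbitSimplePatternRestoration
    (h : ∀ (a b : ℕ → ℕ) (E : (n : ℕ) → Multiset (Fin (a n) × Fin (b n))),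
      (∀ n, a n ≤ n) → (∀ n, b n ≤ n) → (∀ n, Multiset.card (E n) ≤ n) → (∀ n, (E n).Nodup) →
      IsVPFamily (fun n => homPoly (E n) n ℂ) →
      ∃ (G : ℕ → Type) (_ : ∀ n, Fintype (G n)) (D : ∀ n, LabelledArithCircuit ℂ (Fin n × Fin n) Unit (G n)),
        (∀ n, (D n).IsSymmetric (Equiv.Perm (Fin n))) ∧
        (∀ n, (D n).eval ((D n).output ()) = homPoly (E n) n ℂ) ∧
        ∀ δ : ℝ, 0 < δ → ∀ᶠ n : ℕ in atTop,
          ((D n).orbitSize (Equiv.Perm (Fin n)) : ℝ) ≤ (2 : ℝ) ^ (δ * (n : ℝ))) :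
    ValiantsHypothesis := by
  show VP ℂ ≠ VNP ℂ
  intro hEq
  obtain ⟨a, b, E, ha, hb, hE, hnd, hVNP, hsep⟩ := exists_linearlySeparating_simple_vnp_family
  exact not_subexpOrbitSymmetric_of_linearSeparating (fun n => homPoly (E n) n ℂ) hsep
    (h a b E ha hb hE hnd (isVPFamily_of_isVNPFamily_of_VP_eq_VNP hEq hVNP))

/-- **Its `VNP` version is FALSE** (unconditionally). [cite: DawarWilsenach2025, Thm 7.2] -/
theorem not_subexpOrbitSimplePatternRestoration_vnp :
    ¬ ∀ (a b : ℕ → ℕ) (E : (n : ℕ) → Multiset (Fin (a n) × Fin (b n))),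
      (∀ n, a n ≤ n) → (∀ n, b n ≤ n) → (∀ n, Multiset.card (E n) ≤ n) → (∀ n, (E n).Nodup) →
      IsVNPFamily (fun n => homPoly (E n) n ℂ) →
      ∃ (G : ℕ → Type) (_ : ∀ n, Fintype (G n)) (D : ∀ n, LabelledArithCircuit ℂ (Fin n × Fin n) Unit (G n)),
        (∀ n, (D n).IsSymmetric (Equiv.Perm (Fin n))) ∧
        (∀ n, (D n).eval ((D n).output ()) = homPoly (E n) n ℂ) ∧
        ∀ δ : ℝ, 0 < δ → ∀ᶠ n : ℕ in atTop,
          ((D n).orbitSize (Equiv.Perm (Fin n)) : ℝ) ≤ (2 : ℝ) ^ (δ * (n : ℝ)) := by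
  intro h
  obtain ⟨a, b, E, ha, hb, hE, hnd, hVNP, hsep⟩ := exists_linearlySeparating_simple_vnp_family
  exact not_subexpOrbitSymmetric_of_linearSeparating (fun n => homPoly (E n) n ℂ) hsep (h a b E ha hb hE hnd hVNP)

end OrbitRestorationLinearVolumeQPVHStrength

end Summit.ValiantsHypothesis.ValiantsHypothesis.Theorems

end
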